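import Summits.Ventures.PackingBounds.Configurations.DesignIdentities

/-!
# `(7, 56, 1/3)` codes: complementary slackness and the design identities of strengths `1, 2, 3`

Framing: lottery ticket; floor = certified bounds/negative ranges. Venture `PackingBounds` (cell
`pub-packcert`, seat `pub-packcert-energy`) — Cohn–Kumar Table 1, row `(7, 56)`, uniqueness column, step 1 of 3
(`Dim7Card56Frame`, `Dim7Card56Unique`).

For ANY `56`-point code `C ⊂ S⁶` with pairwise inner products `≤ 1/3`, complementary slackness for the sharp
Delsarte certificate `(t + 1)(t + 1/3)²(t - 1/3)` (tree: `SphericalCodes.code_dim7_le_56`) puts all inner products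
in `{1/3, -1/3, -1}` (`inner_of_card_eq_56`) and kills the Gegenbauer moments of orders `1…4`
(`moments_of_card_eq_56`); by `DesignIdentities` this gives, for all vectors `u, v, z`:
`Σ_w ⟪u,w⟫ = 0`, `Σ_w ⟪u,w⟫⟪v,w⟫ = 8⟪u,v⟫`, `Σ_w ⟪u,w⟫⟪v,w⟫⟪z,w⟫ = 0`.

## References
* E. Bannai, N. J. A. Sloane, Canad. J. Math. 33 (1981) 437–449 (= Conway–Sloane, *SPLAG*, Ch. 14 Thm 10–12). [`ConwaySloane1999`]
* H. Cohn, A. Kumar, J. Amer. Math. Soc. 20 (2007) 99–148, Table 1 and Appendix A. [`CohnKumar2006`]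
-/

noncomputable section

namespace Summit.Ventures.PackingBounds.Config.Dim7Card56Unique

open Finset Module Literature.Analysis.SpecialFunctions Literature.Geometry.DiscreteGeometry

/-! ### Complementary slackness -/

/-- The sharp certificate `(t + 1)(t + 1/3)²(t - 1/3)` in the Gegenbauer basis of `S⁶` (`μ = 5/2`). -/
private theorem hpoly (t : ℝ) : ∑ k ∈ range (4 + 1),
    (fun k => match k with
      | 0 => 8 / 189 | 1 => 8 / 135 | 2 => 152 / 3465 | 3 => 8 / 315 | 4 => 8 / 1155 | _ => 0) k *
      gegenbauerSum ((5 / 2 : ℝ)) k t = (t + 1) * (t + 1 / 3) ^ 2 * (t - 1 / 3) := by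
  simp [Finset.sum_range_succ, gegenbauerSum, gegenbauerCoeff, Finset.prod_range_succ, Nat.factorial]
  ring

section config

variable {C : Finset (EuclideanSpace ℝ (Fin 7))} (h1 : ∀ x ∈ C, ‖x‖ = 1)
  (h2 : ∀ x ∈ C, ∀ y ∈ C, x ≠ y → inner ℝ x y ≤ 1 / 3) (hN : C.card = 56)
include h1 h2 hN

/-- **Inner products of a `(7, 56, 1/3)` code** lie in `{1/3, -1/3, -1}`. [cite: ConwaySloane1999, Ch. 14 Thm. 10] -/
theorem inner_of_card_eq_56 {x y : EuclideanSpace ℝ (Fin 7)} (hx : x ∈ C) (hy : y ∈ C) (hxy : x ≠ y) :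
    inner ℝ x y = 1 / 3 ∨ inner ℝ x y = -1 / 3 ∨ inner ℝ x y = -1 := by
  have h0 := DelsarteLP.sum_eq_zero_of_card_mul_eq (n := 7) (μ := 5 / 2) (by norm_num) (by norm_num) 4
    (fun k => match k with
      | 0 => 8 / 189 | 1 => 8 / 135 | 2 => 152 / 3465 | 3 => 8 / 315 | 4 => 8 / 1155 | _ => 0)
    ?_ (1 / 3) ?_ C h1 h2 ?_ hx hy hxy
  · rw [hpoly] at h0
    rcases mul_eq_zero.mp h0 with h | h
    · rcases mul_eq_zero.mp h with h | h
      · right; right; linarith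
      · right; left
        have := pow_eq_zero_iff two_ne_zero |>.mp h
        linarith
    · left; linarith
  · intro k; split <;> norm_num
  · intro t ht1 ht2
    rw [hpoly]
    exact mul_nonpos_of_nonneg_of_nonpos (mul_nonneg (by linarith) (by positivity)) (by linarith)
  · rw [hN]
    norm_num [Finset.sum_range_succ, gegenbauerSum, gegenbauerCoeff, Finset.prod_range_succ, Nat.factorial]

/-- **Design property**: the Gegenbauer moments of orders `1…4` of a `(7, 56, 1/3)` code vanish.
[cite: ConwaySloane1999, Ch. 14 Thm. 10] -/
theorem moments_of_card_eq_56 {k : ℕ} (hk1 : 1 ≤ k) (hk2 : k ≤ 4) :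
    ∑ x ∈ C, ∑ y ∈ C, gegenbauerSum ((5 / 2 : ℝ)) k (inner ℝ x y) = 0 := by
  classical
  have hinner : ∀ a b : EuclideanSpace ℝ (Fin 7), inner ℝ a b = ∑ j, a j * b j := fun a b => by
    simp [PiLp.inner_apply, mul_comm]
  have key := DelsarteLP.sum_sum_gegenbauerSum_eq_zero_of_card_mul_eq_coord (n := 7) (μ := 5 / 2)
    (by norm_num) (by norm_num) 4
    (fun k => match k with
      | 0 => 8 / 189 | 1 => 8 / 135 | 2 => 152 / 3465 | 3 => 8 / 315 | 4 => 8 / 1155 | _ => 0)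
    ?_ (1 / 3) ?_ (ι := C) (fun a j => (a : EuclideanSpace ℝ (Fin 7)) j) ?_ ?_ ?_
    (k := k) (Finset.mem_range.2 (by omega)) hk1 ?_
  · have hco : ∑ x ∈ C, ∑ y ∈ C, gegenbauerSum ((5 / 2 : ℝ)) k (inner ℝ x y) =
        ∑ a : C, ∑ b : C, gegenbauerSum ((5 / 2 : ℝ)) k
          (∑ j, (a : EuclideanSpace ℝ (Fin 7)) j * (b : EuclideanSpace ℝ (Fin 7)) j) := by
      rw [← Finset.sum_coe_sort C]
      refine Finset.sum_congr rfl fun a _ => ?_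
      rw [← Finset.sum_coe_sort C]
      exact Finset.sum_congr rfl fun b _ => by rw [hinner]
    rw [hco]
    exact key
  · intro k; split <;> norm_num
  · intro t ht1 ht2
    rw [hpoly]
    exact mul_nonpos_of_nonneg_of_nonpos (mul_nonneg (by linarith) (by positivity)) (by linarith)
  · intro a
    rw [← EuclideanSpace.real_norm_sq_eq, h1 a a.2, one_pow]
  · intro a b hab
    have hne : (a : EuclideanSpace ℝ (Fin 7)) ≠ b := fun h => hab (Subtype.ext h)
    have h := h2 a a.2 b b.2 hne
    rwa [hinner] at h
  · rw [Fintype.card_coe, hN]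
    norm_num [Finset.sum_range_succ, gegenbauerSum, gegenbauerCoeff, Finset.prod_range_succ, Nat.factorial]
  · interval_cases k <;> norm_num

/-- Strength `1`: `Σ_{w ∈ C} ⟪u, w⟫ = 0`. -/
theorem sum_inner_eq_zero (u : EuclideanSpace ℝ (Fin 7)) : ∑ w ∈ C, inner ℝ u w = 0 :=
  DesignIdentities.sum_inner_eq_zero (μ := 5 / 2) (by norm_num) C
    (moments_of_card_eq_56 h1 h2 hN le_rfl (by norm_num)) u

/-- Strength `2`: `Σ_{w ∈ C} ⟪u, w⟫ ⟪v, w⟫ = 8 ⟪u, v⟫`. -/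
theorem sum_inner_mul_inner (u v : EuclideanSpace ℝ (Fin 7)) :
    ∑ w ∈ C, inner ℝ u w * inner ℝ v w = 8 * inner ℝ u v := by
  have h := DesignIdentities.sum_inner_mul_inner (n := 7) (μ := 5 / 2) (by norm_num) (by norm_num) C h1
    (moments_of_card_eq_56 h1 h2 hN (by norm_num) (by norm_num)) u v
  rw [h, hN]
  norm_num

/-- Strength `3`: `Σ_{w ∈ C} ⟪u, w⟫ ⟪v, w⟫ ⟪z, w⟫ = 0`. -/
theorem sum_inner_mul_inner_mul_inner (u v z : EuclideanSpace ℝ (Fin 7)) :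
    ∑ w ∈ C, inner ℝ u w * inner ℝ v w * inner ℝ z w = 0 :=
  DesignIdentities.sum_inner_mul_inner_mul_inner (n := 7) (μ := 5 / 2) (by norm_num) (by norm_num) C h1
    (moments_of_card_eq_56 h1 h2 hN le_rfl (by norm_num)) (moments_of_card_eq_56 h1 h2 hN (by norm_num) (by norm_num))
    u v z

end config

end Summit.Ventures.PackingBounds.Config.Dim7Card56Unique

end
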